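import Literature.Probability.RandomPlanarGeometry.SLEImageDriverFunctional
import Literature.Probability.RandomPlanarGeometry.StarShiftOuterContinuity
import HarnessLib

/-!
# `ω ↦ L_{B_t(ω)}` is a random variable: measurability of the image driving functional

[LSW] 2003 §5: along the SLE_κ hulls and a `*`-hull `A` not yet reached, the image driving value
is `W̃_t = W_t + L_A − L_{B_t}` with `B_t = slidHull W A t = g_t(A) − W_t` and `L_B = starShift B`
the constant term of the reflected canonical map `E_B(z) = z + L_B + o(1)` (`StarHullCanonical`).
For the martingale/one-step analysis of `W̃` one needs `ω ↦ L_{B_t(ω)}` to be a random variable,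
adapted to the driving filtration. This file proves:

* `measurable_indicator_starShift_slidHull` — for a family of continuous drivers `W ω` from `0`
  with measurable values at times `≤ t` and a nonempty `*`-hull `A`,
  `ω ↦ L_{B_t(ω)} · 𝟙{alive at t}` is measurable (the verbatim `L`-analogue of
  `measurable_indicator_starDeriv_slidHull` of `SLERestrictionDerivMeasurable`: on the alive
  event the slid points `b_k(ω) = g_t(a_k) − W_t` are dense in the `*`-hull `B_t(ω)` and
  measurable, the dyadic outer hulls are functions of the measurable FINITE configurations
  `slidConfig`, and `L` is continuous along them, `tendsto_starShift_outerHull` of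
  `StarShiftOuterContinuity`; a pointwise limit of measurable functions is measurable);
* `measurable_LFnK`, `measurable_imageDrvFnK` — the path functionals
  `LFnK κ A t = L_{B_t} 𝟙{alive}` and `imageDrvFnK κ A t = W_t − LFnK κ A t` of
  `SLEImageDriverFunctional` (driver `drvK κ υ = √κ (υ − υ 0)`) are measurable on `C(ℝ≥0, ℝ)`;
* `adapted_LFnK_brownianCPath`, `adapted_imageDrvFnK_brownianCPath` — composed with the
  Brownian path, they are adapted to the Brownian filtration (as `adapted_DhatpK`).

The indicator-of-alive convention (value `0` off the alive event) is kept throughout: the slid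
hull of a dead path is not a `*`-hull and `starShift` is junk there.

## References

* G. F. Lawler, O. Schramm, W. Werner, *Conformal restriction: the chordal case* (2003), §5
  [LawlerSchrammWerner2003Restriction].
* G. F. Lawler, *Conformally Invariant Processes in the Plane*, AMS (2005), §4.6.1
  (W̃, Prop. 4.40–4.41) [Lawler2005].
-/

noncomputable section

open Set Filter Metric Function MeasureTheory Bornology
open _root_.Complex _root_.Topology
open Literature.Probability.Process (brownian preWienerMeasure)
open scoped NNReal

namespace Literature.Probability.RandomPlanarGeometry

open Loewner PathOps

/-! ### Measurability of `L_{B_t} 𝟙{alive}` for a measurable family of drivers -/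

section Family

variable {Ω : Type*} [MeasurableSpace Ω] {W : Ω → ℝ≥0 → ℝ} {A : Set ℂ} {t : ℝ≥0}

/-- **`ω ↦ L_{B_t(ω)} · 𝟙{alive}` is measurable** (`B_t = slidHull (W ω) A t = g_t(A) − W_t`,
`L = starShift`), for continuous drivers from `0` with measurable values at times `≤ t` and a
nonempty `*`-hull `A`: pointwise limit, on the alive event, of `L` of the dyadic outer hulls of the
measurable finite configurations `slidConfig` (`tendsto_starShift_outerHull`).
[cite: LawlerSchrammWerner2003Restriction, §5 (W̃_t = W_t + L_A − L_{B_t})] -/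
theorem measurable_indicator_starShift_slidHull (hc : ∀ ω, Continuous (W ω))
    (hW0 : ∀ ω, W ω 0 = 0) (hmeas : ∀ s, s ≤ t → Measurable fun ω ↦ W ω s)
    (hA : IsStarHull A) (hne : A.Nonempty) :
    Measurable fun ω ↦ Set.indicator {ω | Disjoint (closedHull (W ω) t) A}
      (fun ω ↦ (starShift (slidHull (W ω) A t)).re) ω := by
  classical
  obtain ⟨a, ha, hdense⟩ := exists_denseSeq hA hne
  have hAb : IsBounded A := hA.isBoundedHull.isCompact.isBounded
  have hEm := measurableSet_disjoint_closedHull hc hW0 hmeas hA hne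
  -- the approximants `L` of the dyadic outer hulls of the finite configurations
  set G : ℕ → Ω → ℝ := fun n ω ↦
    (starShift (outerHull n (slidConfig hc hAb ha t n ω : Set (ℤ × ℤ)))).re with hG
  have hGm : ∀ n, Measurable (G n) := fun n ↦
    (@measurable_from_top _ _ _ (f := fun F : Finset (ℤ × ℤ) ↦
      (starShift (outerHull n (F : Set (ℤ × ℤ)))).re)).comp (measurable_slidConfig hc hAb ha hmeas n)
  have hGm' : ∀ n, Measurable fun ω ↦
      Set.indicator {ω | Disjoint (closedHull (W ω) t) A} (G n) ω := fun n ↦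
    (hGm n).indicator hEm
  refine measurable_of_tendsto_metrizable hGm' (tendsto_pi_nhds.2 fun ω ↦ ?_)
  by_cases hω : Disjoint (closedHull (W ω) t) A
  · simp only [Set.indicator_of_mem (show ω ∈ {ω | Disjoint (closedHull (W ω) t) A} from hω)]
    have hB := Loewner.isStarHull_slidHull_of_disjoint (hc ω) hA hω
    have hb : ∀ k, slidPt W a t k ω ∈ slidHull (W ω) A t := fun k ↦
      slidPt_mem (fun k ↦ (ha k).1) k ω
    have hd := slidHull_subset_closure_range_slidPt (hc ω) hA hdense hω
    have := (continuous_re.tendsto _).comp (tendsto_starShift_outerHull hB (hne.image _) hb hd)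
    simp only [hG, coe_slidConfig]
    exact this
  · simp only [Set.indicator_of_notMem (show ω ∉ {ω | Disjoint (closedHull (W ω) t) A} from hω)]
    exact tendsto_const_nhds

end Family

/-! ### The path functionals `LFnK`, `imageDrvFnK` are measurable -/

section PathMeasurable

variable [MeasurableSpace C(ℝ≥0, ℝ)] [BorelSpace C(ℝ≥0, ℝ)]

/-- **`LFnK κ A t = L_{B_t} 𝟙{alive}` is a measurable functional of the path.**
[cite: LawlerSchrammWerner2003Restriction, §5 (h_t, W̃_t)] -/
theorem measurable_LFnK (κ : ℝ≥0) {A : Set ℂ} (hA : IsStarHull A) (hne : A.Nonempty) (t : ℝ≥0) :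
    Measurable (LFnK κ A t) :=
  measurable_indicator_starShift_slidHull (W := fun υ : C(ℝ≥0, ℝ) ↦ drvK κ υ)
    (fun υ ↦ continuous_drvK κ υ) (drvK_zero κ) (fun s _ ↦ measurable_drvK_apply κ s) hA hne

/-- **The image driving functional `imageDrvFnK κ A t = W_t − L_{B_t} 𝟙{alive}` is measurable.**
[cite: LawlerSchrammWerner2003Restriction, §5 (W̃_t = h_t(W_t))] -/
theorem measurable_imageDrvFnK (κ : ℝ≥0) {A : Set ℂ} (hA : IsStarHull A) (hne : A.Nonempty)
    (t : ℝ≥0) : Measurable (imageDrvFnK κ A t) :=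
  (measurable_drvK_apply κ t).sub (measurable_LFnK κ hA hne t)

end PathMeasurable

/-! ### Adaptedness along the Brownian path -/

section Processes

variable (κ : ℝ≥0) {A : Set ℂ}

/-- **`t ↦ L_{B_t} 𝟙{alive}` along the Brownian path is adapted** to the Brownian filtration (the
driver values `drvK κ (brownianCPath ω) s`, `s ≤ t`, are `𝓕_t`-measurable). [folklore] -/
theorem adapted_LFnK_brownianCPath (hA : IsStarHull A) (hne : A.Nonempty) :
    Adapted brownianFiltration (fun t ω ↦ LFnK κ A t (brownianCPath ω)) := fun t ↦
  @measurable_indicator_starShift_slidHull (ℝ≥0 → ℝ) (brownianFiltration t)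
    (fun ω : ℝ≥0 → ℝ ↦ drvK κ (brownianCPath ω)) A t (fun _ ↦ continuous_drvK κ _)
    (fun _ ↦ drvK_zero κ _) (fun _ hs ↦ measurable_drvK_brownianCPath_of_le hs) hA hne

/-- **The image driving process `t ↦ imageDrvFnK κ A t (brownianCPath ω)` is adapted** to the
Brownian filtration. [cite: LawlerSchrammWerner2003Restriction, §5 (W̃_t)] -/
theorem adapted_imageDrvFnK_brownianCPath (hA : IsStarHull A) (hne : A.Nonempty) :
    Adapted brownianFiltration (fun t ω ↦ imageDrvFnK κ A t (brownianCPath ω)) := fun t ↦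
  (measurable_drvK_brownianCPath_of_le le_rfl).sub (adapted_LFnK_brownianCPath κ hA hne t)

end Processes

end Literature.Probability.RandomPlanarGeometry
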